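import Literature.NumberTheory.CubicFields.BinaryCubicForms
import Literature.Computability.Complexity.ZIntBricks
import Literature.Computability.Complexity.PlumbingBricks

/-!
# Crux `ArithStatLadder.IqThreeNotPPoly` (stmt-QuantumAdvantage-2422)

Stub `stub_samplerFP` of the line `Sketch` (SQUAREFREE-FILTER DOMINATION): the sampler of the planted
congruence family of binary cubic forms is a polynomial-time string function.

On an input pair `⟨x, r⟩` (modulus numeral `x`, `N = ⟦x⟧ = bitsToNat x`, and seed `r`), split `r`
into four consecutive chunks of width `w = |r| / 4` (the fourth chunk is everything after `3w`),
read them as little-endian naturals `a b c e`, form the binary cubic form `(N a, N b, c, e)` and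
output the canonical numeral of `|Disc (N a, N b, c, e)|`
(`Disc = b'²c² − 4a'c³ − 4b'³e − 27a'²e² + 18a'b'ce`, `a' = N a`, `b' = N b`).

The witness is an explicit composition of the tree's `FP` bricks (no machine is written):
* the width `1^{|r|/4}` by `Plumb.divModFn ⟨1⁴, 1^{|r|}⟩`, the chunks by `Plumb.takeFn` /
  `Plumb.dropFn` (`exists_parse`);
* the quartic `Disc` in the difference-pair integer code of `ZIntBricks.lean` (`zmulF`, `zaddF`,
  `zsubF`, `zcanonF`, values tracked through `Brick.ival`; `exists_arith`);
* the absolute value as `addFn` of the two canonical components (`bitsToNat_cP_add_cQ`).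
Membership in `FP` is by the closure lemmas `comp_mem_FP`, `fanoutFn_mem_FP`, `const_mem_FP`; the
closed form holds on every input (all functions are total).
-/

noncomputable section

set_option linter.dupNamespace false -- D-0017: single-problem summit ⇒ `QuantumAdvantage.QuantumAdvantage` by design

namespace Summit.QuantumAdvantage.QuantumAdvantage.Theorems.IqThreeNotPPoly

open scoped Classical
open _root_.Computability Literature.Computability.Complexity
open Literature.Computability.Complexity.Brick Literature.Computability.Complexity.Plumb
open Literature.NumberTheory.CubicFields (BinaryCubic)

/-! ### Integer-valued `FP` expressions (values tracked through `Brick.ival`) -/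

/-- A numeral-valued brick `p ∈ FP` lifts to an integer code of value `⟦p z⟧` (pair it with `ε`). -/
private theorem exists_ival_nat {p : List Bool → List Bool} (hp : p ∈ FP) :
    ∃ m ∈ FP, ∀ z, ival (m z) = (bitsToNat (p z) : ℤ) :=
  ⟨fanoutFn p (fun _ => []), fanoutFn_mem_FP hp (const_mem_FP _), fun z => by simp⟩

/-- Integer constants are `FP` expressions. -/
private theorem exists_ival_const (c : ℤ) : ∃ m ∈ FP, ∀ z, ival (m z) = c :=
  ⟨fun _ => dpEnc c, const_mem_FP _, fun _ => ival_dpEnc c⟩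

/-- Products of `FP` expressions (`zmulF`). -/
private theorem exists_ival_mul {φ ψ : List Bool → ℤ}
    (hφ : ∃ m ∈ FP, ∀ z, ival (m z) = φ z) (hψ : ∃ m ∈ FP, ∀ z, ival (m z) = ψ z) :
    ∃ m ∈ FP, ∀ z, ival (m z) = φ z * ψ z := by
  obtain ⟨p, hp, hpv⟩ := hφ
  obtain ⟨q, hq, hqv⟩ := hψ
  exact ⟨zmulF ∘ fanoutFn p q, comp_mem_FP zmulF_mem_FP (fanoutFn_mem_FP hp hq), fun z => by
    rw [Function.comp_apply, fanoutFn_apply, zmulF_boolPair, ival_dpEnc, hpv, hqv]⟩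

/-- Sums of `FP` expressions (`zaddF`). -/
private theorem exists_ival_add {φ ψ : List Bool → ℤ}
    (hφ : ∃ m ∈ FP, ∀ z, ival (m z) = φ z) (hψ : ∃ m ∈ FP, ∀ z, ival (m z) = ψ z) :
    ∃ m ∈ FP, ∀ z, ival (m z) = φ z + ψ z := by
  obtain ⟨p, hp, hpv⟩ := hφ
  obtain ⟨q, hq, hqv⟩ := hψ
  exact ⟨zaddF ∘ fanoutFn p q, comp_mem_FP zaddF_mem_FP (fanoutFn_mem_FP hp hq), fun z => by
    rw [Function.comp_apply, fanoutFn_apply, zaddF_boolPair, ival_dpEnc, hpv, hqv]⟩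

/-- Differences of `FP` expressions (`zsubF`). -/
private theorem exists_ival_sub {φ ψ : List Bool → ℤ}
    (hφ : ∃ m ∈ FP, ∀ z, ival (m z) = φ z) (hψ : ∃ m ∈ FP, ∀ z, ival (m z) = ψ z) :
    ∃ m ∈ FP, ∀ z, ival (m z) = φ z - ψ z := by
  obtain ⟨p, hp, hpv⟩ := hφ
  obtain ⟨q, hq, hqv⟩ := hψ
  exact ⟨zsubF ∘ fanoutFn p q, comp_mem_FP zsubF_mem_FP (fanoutFn_mem_FP hp hq), fun z => by
    rw [Function.comp_apply, fanoutFn_apply, zsubF_boolPair, ival_dpEnc, hpv, hqv]⟩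

/-- Canonical output of an `FP` expression (`zcanonF`): the code `dpEnc` of its value. -/
private theorem exists_canon {φ : List Bool → ℤ} (hφ : ∃ m ∈ FP, ∀ z, ival (m z) = φ z) :
    ∃ m ∈ FP, ∀ z, m z = dpEnc (φ z) := by
  obtain ⟨p, hp, hpv⟩ := hφ
  exact ⟨zcanonF ∘ p, comp_mem_FP zcanonF_mem_FP hp, fun z => by
    rw [Function.comp_apply, zcanonF_eq, hpv]⟩

/-- The absolute value of a canonical code as a numeral: `addFn (dpEnc z) = bin |z|`. -/
private theorem addFn_dpEnc (z : ℤ) : addFn (dpEnc z) = encodeNat z.natAbs := by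
  rw [dpEnc_eq, addFn_boolPair, bitsToNat_cP_add_cQ]

/-! ### The arithmetic stage: the discriminant of the planted form on a parsed record -/

/-- On records `⟨x, ⟨sa, ⟨sb, ⟨sc, sd⟩⟩⟩⟩` an `FP` function outputs the canonical code of
`Disc (⟦x⟧⟦sa⟧, ⟦x⟧⟦sb⟧, ⟦sc⟧, ⟦sd⟧)`. -/
private theorem exists_arith : ∃ h ∈ FP, ∀ x sa sb sc sd : List Bool,
    h (boolPair x (boolPair sa (boolPair sb (boolPair sc sd)))) =
      dpEnc (BinaryCubic.disc (R := ℤ)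
        { a := (bitsToNat x : ℤ) * (bitsToNat sa : ℤ), b := (bitsToNat x : ℤ) * (bitsToNat sb : ℤ),
          c := (bitsToNat sc : ℤ), d := (bitsToNat sd : ℤ) }) := by
  have hN : ∃ m ∈ FP, ∀ z, ival (m z) = (bitsToNat (nthF 0 z) : ℤ) := exists_ival_nat (nthF_mem_FP 0)
  have hA := exists_ival_mul hN (exists_ival_nat (nthF_mem_FP 1))
  have hB := exists_ival_mul hN (exists_ival_nat (nthF_mem_FP 2))
  have hC : ∃ m ∈ FP, ∀ z, ival (m z) = (bitsToNat (nthF 3 z) : ℤ) := exists_ival_nat (nthF_mem_FP 3)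
  have hD : ∃ m ∈ FP, ∀ z, ival (m z) = (bitsToNat (sndPow 3 z) : ℤ) := exists_ival_nat (sndPow_mem_FP 3)
  -- `b'²c² − 4a'c³ − 4b'³d − 27a'²d² + 18a'b'cd`
  have hDisc := exists_ival_add
    (exists_ival_sub (exists_ival_sub (exists_ival_sub
      (exists_ival_mul (exists_ival_mul hB hB) (exists_ival_mul hC hC))
      (exists_ival_mul (exists_ival_mul (exists_ival_const 4) hA) (exists_ival_mul hC (exists_ival_mul hC hC))))
      (exists_ival_mul (exists_ival_mul (exists_ival_const 4) (exists_ival_mul hB (exists_ival_mul hB hB))) hD))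
      (exists_ival_mul (exists_ival_mul (exists_ival_const 27) (exists_ival_mul hA hA)) (exists_ival_mul hD hD)))
    (exists_ival_mul (exists_ival_mul (exists_ival_const 18) (exists_ival_mul hA hB)) (exists_ival_mul hC hD))
  obtain ⟨h, hh, hhv⟩ := exists_canon hDisc
  refine ⟨h, hh, fun x sa sb sc sd => ?_⟩
  rw [hhv]
  congr 1
  simp only [nthF_succ_boolPair, nthF_zero_boolPair, sndPow_succ_boolPair, sndPow_zero_boolPair,
    BinaryCubic.disc_eq]
  ring

/-! ### The parsing stage: four chunks of width `|r| / 4` -/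

/-- A unary yardstick of length `|r| / 4` is computable from `⟨x, r⟩` (`divModFn ⟨1⁴, 1^{|r|}⟩`). -/
private theorem exists_width : ∃ u ∈ FP, ∀ x r : List Bool, (u (boolPair x r)).length = r.length / 4 := by
  refine ⟨fstF ∘ divModFn ∘ fanoutFn (fun _ => ones 4) (onesFn ∘ sndF),
    comp_mem_FP fstF_mem_FP (comp_mem_FP divModFn_mem_FP
      (fanoutFn_mem_FP (const_mem_FP _) (comp_mem_FP onesFn_mem_FP sndF_mem_FP))), fun x r => ?_⟩
  have e : onesFn r = ones r.length := OracleCompose.unaryEncodeNat_eq_replicate _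
  simp only [Function.comp_apply, fanoutFn_apply, sndF_boolPair, e, divModFn_boolPair, fstF_boolPair]
  simp

/-- **Parsing**: `⟨x, r⟩ ↦ ⟨x, ⟨r ↾ w, ⟨(r ⇂ w) ↾ w, ⟨(r ⇂ 2w) ↾ w, r ⇂ 3w⟩⟩⟩⟩`, `w = |r| / 4`, in `FP`. -/
private theorem exists_parse : ∃ g ∈ FP, ∀ x r : List Bool,
    g (boolPair x r) = boolPair x (boolPair (r.take (r.length / 4))
      (boolPair ((r.drop (r.length / 4)).take (r.length / 4))
        (boolPair ((r.drop (2 * (r.length / 4))).take (r.length / 4)) (r.drop (3 * (r.length / 4)))))) := by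
  obtain ⟨u, hu, huv⟩ := exists_width
  have hd1 : dropFn ∘ fanoutFn u sndF ∈ FP := comp_mem_FP dropFn_mem_FP (fanoutFn_mem_FP hu sndF_mem_FP)
  have hd2 : dropFn ∘ fanoutFn u (dropFn ∘ fanoutFn u sndF) ∈ FP :=
    comp_mem_FP dropFn_mem_FP (fanoutFn_mem_FP hu hd1)
  have hd3 : dropFn ∘ fanoutFn u (dropFn ∘ fanoutFn u (dropFn ∘ fanoutFn u sndF)) ∈ FP :=
    comp_mem_FP dropFn_mem_FP (fanoutFn_mem_FP hu hd2)
  refine ⟨fanoutFn fstF (fanoutFn (takeFn ∘ fanoutFn u sndF)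
      (fanoutFn (takeFn ∘ fanoutFn u (dropFn ∘ fanoutFn u sndF))
        (fanoutFn (takeFn ∘ fanoutFn u (dropFn ∘ fanoutFn u (dropFn ∘ fanoutFn u sndF)))
          (dropFn ∘ fanoutFn u (dropFn ∘ fanoutFn u (dropFn ∘ fanoutFn u sndF)))))),
    fanoutFn_mem_FP fstF_mem_FP (fanoutFn_mem_FP (comp_mem_FP takeFn_mem_FP (fanoutFn_mem_FP hu sndF_mem_FP))
      (fanoutFn_mem_FP (comp_mem_FP takeFn_mem_FP (fanoutFn_mem_FP hu hd1))
        (fanoutFn_mem_FP (comp_mem_FP takeFn_mem_FP (fanoutFn_mem_FP hu hd2)) hd3))),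
    fun x r => ?_⟩
  simp only [fanoutFn_apply, Function.comp_apply, fstF_boolPair, sndF_boolPair, takeFn_boolPair,
    dropFn_boolPair, huv, List.drop_drop]
  rw [show r.length / 4 + r.length / 4 = 2 * (r.length / 4) by ring,
    show 2 * (r.length / 4) + r.length / 4 = 3 * (r.length / 4) by ring]

/-! ### The registered stub -/

/-- **STUB E · `stub_samplerFP`.** The sampler of the planted congruence family — on `⟨x, r⟩`, with
`N = ⟦x⟧`, `w = |r| / 4` and `a b c e` the four consecutive `w`-bit chunks of `r` (the last one takes
the rest), output the canonical numeral of `|Disc (N a, N b, c, e)|` — is a polynomial-time string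
function: `addFn ∘ arith ∘ parse` with the stages `exists_parse`, `exists_arith` and the absolute
value `addFn_dpEnc`. -/
theorem stub_samplerFP :
    ∃ f : List Bool → List Bool, f ∈ FP ∧ ∀ x r : List Bool,
      f (boolPair x r) = encodeNat (Int.natAbs (BinaryCubic.disc (R := ℤ)
        { a := (bitsToNat x : ℤ) * (bitsToNat (r.take (r.length / 4)) : ℤ),
          b := (bitsToNat x : ℤ) * (bitsToNat ((r.drop (r.length / 4)).take (r.length / 4)) : ℤ),
          c := (bitsToNat ((r.drop (2 * (r.length / 4))).take (r.length / 4)) : ℤ),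
          d := (bitsToNat (r.drop (3 * (r.length / 4))) : ℤ) })) := by
  obtain ⟨g, hg, hgv⟩ := exists_parse
  obtain ⟨h, hh, hhv⟩ := exists_arith
  refine ⟨addFn ∘ h ∘ g, comp_mem_FP addFn_mem_FP (comp_mem_FP hh hg), fun x r => ?_⟩
  rw [Function.comp_apply, Function.comp_apply, hgv, hhv, addFn_dpEnc]

end Summit.QuantumAdvantage.QuantumAdvantage.Theorems.IqThreeNotPPoly

end
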